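import Summits.KontsevichZagierPeriods.KontsevichZagierPeriods.Theorems.HermiteRigidityDilogRigidityCubeTwoSeriesLevel
import Mathlib.MeasureTheory.Integral.Pi
import Mathlib.MeasureTheory.Integral.DominatedConvergence
import Mathlib.Analysis.SpecificLimits.Basic
import Mathlib.Analysis.SpecificLimits.Normed
import Mathlib.Analysis.SpecialFunctions.Integrals.Basic

/-!
# `ReductionRigidity` (stmt-KontsevichZagierPeriods-3407), line `Sketch` (cycle-2 growth: the
# LANDEN JOIN island): stub `stub_joinValueNegLevel`

THE VALUE OF THE NEGATIVE-LEVEL WEIGHT-TWO NORMAL FORM. For a natural `q ≥ 3`, at the level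
`ν = 1 − q ≤ −2`,

  `∫_{[0,1]²} dx dy / ((1 − q) − x y) = ∑_{k ≥ 0} (1/(1 − q))^{k+1} / (k+1)² = Li₂(1/(1 − q))`,

the fourth number of Viola–Zudilin's theorem (`1, Li₁(1/q), Li₂(1/q), Li₂(1/(1 − q))`).

We prove the statement at every real level `ν` with `|ν| > 1` (`integral_cube_two_one_div_absLevel`),
which covers the positive levels `ν ≥ 2` of `stub_cubeTwoIntegralSeriesLevel`
(`HermiteRigidityDilogRigidityCubeTwoSeriesLevel.lean`) and the negative levels `ν ≤ −2` needed here
at once: on the cube `u = x y ∈ [0, 1]`, so `|u/ν| ≤ 1/|ν| < 1` and the geometric expansion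
`1/(ν − u) = (1/ν) · 1/(1 − u/ν) = ∑_k (1/ν)^{k+1} u^k` (`hasSum_geometric_of_abs_lt_one`) is
absolutely convergent (alternating when `ν < 0`); `∫` and `∑` are swapped by
`MeasureTheory.integral_tsum_of_summable_integral_norm`, the norms of the terms integrating to
`|1/ν|^{k+1}/(k+1)²`, a sequence dominated by the geometric series `∑ |1/ν|^{k+1}`; termwise,
`∫_{[0,1]²} (x y)^k = 1/(k+1)²` is the landed `integral_cube_two_mul_pow`.
-/

noncomputable section

open MeasureTheory Set

namespace Summit.KontsevichZagierPeriods.HermiteRigidity.ReductionRigidity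

open Literature.NumberTheory.Transcendental
open Literature.NumberTheory.Transcendental.KZ

/-! ## The series `∫_{[0,1]²} dx dy/(ν − x y) = ∑_k ν^{-(k+1)}/(k+1)²` for real `|ν| > 1` -/

/-- **The weight-two normal form as a dilogarithm series, real level of either sign**: for a real
`ν` with `|ν| > 1`, `∫_{[0,1]²} dx dy/(ν − x y) = ∑_{k ≥ 0} (1/ν)^{k+1}/(k+1)² (= Li₂(1/ν))`, by
termwise integration of the geometric expansion `1/(ν − x y) = ∑_k (x y)^k/ν^{k+1}`, absolutely
convergent on the closed square since `|x y/ν| ≤ 1/|ν| < 1`. [folklore] -/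
theorem integral_cube_two_one_div_absLevel (ν : ℝ) (hν : 1 < |ν|) :
    ∫ p in cube 2, 1 / (ν - p 0 * p 1) = ∑' k : ℕ, (1 / ν) ^ (k + 1) / ((k : ℝ) + 1) ^ 2 := by
  have hνabs : (0 : ℝ) < |ν| := by linarith
  have hνne : ν ≠ 0 := abs_pos.mp hνabs
  -- the ratio of the dominating geometric series
  have hρ1 : |1 / ν| < 1 := by
    rw [abs_div, abs_one, div_lt_one hνabs]
    exact hν
  -- the terms of the expansion
  set F : ℕ → (Fin 2 → ℝ) → ℝ := fun k p => (1 / ν) ^ (k + 1) * (p 0 * p 1) ^ k with hF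
  -- bounds on `u = x y` on the cube
  have hu : ∀ p ∈ cube 2, 0 ≤ p 0 * p 1 ∧ p 0 * p 1 ≤ 1 := fun p hp =>
    ⟨mul_nonneg (hp 0).1 (hp 1).1, mul_le_one₀ (hp 0).2 (hp 1).1 (hp 1).2⟩
  -- pointwise (absolutely convergent) geometric expansion on the cube
  have hexp : EqOn (fun p : Fin 2 → ℝ => 1 / (ν - p 0 * p 1)) (fun p => ∑' k, F k p)
      (cube 2) := by
    intro p hp
    obtain ⟨h0, h1⟩ := hu p hp
    have hr : |p 0 * p 1 / ν| < 1 := by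
      rw [abs_div, abs_of_nonneg h0, div_lt_one hνabs]
      linarith
    have hne : ν - p 0 * p 1 ≠ 0 := by
      intro h
      have hνeq : ν = p 0 * p 1 := by linarith
      rw [hνeq, abs_of_nonneg h0] at hν
      linarith
    have hgeom := (hasSum_geometric_of_abs_lt_one hr).mul_left (1 / ν)
    have hval : 1 / ν * (1 - p 0 * p 1 / ν)⁻¹ = 1 / (ν - p 0 * p 1) := by
      field_simp
    have hterm : (fun k : ℕ => 1 / ν * (p 0 * p 1 / ν) ^ k) = fun k => F k p := by
      funext k
      simp only [hF]
      ring
    rw [hval, hterm] at hgeom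
    exact hgeom.tsum_eq.symm
  -- each term is integrable on the cube
  have hint : ∀ k, Integrable (F k) (volume.restrict (cube 2)) := by
    intro k
    have hc : Continuous (F k) := by
      simp only [hF]
      fun_prop
    exact hc.continuousOn.integrableOn_compact isCompact_cube
  -- the value of each termwise integral
  have hval : ∀ k, ∫ p in cube 2, F k p = (1 / ν) ^ (k + 1) / ((k : ℝ) + 1) ^ 2 := by
    intro k
    simp only [hF]
    rw [integral_const_mul, integral_cube_two_mul_pow, mul_one_div]
  -- the norms: `‖F k p‖ = |1/ν|^(k+1) (x y)^k` on the cube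
  have hnorm : ∀ k, ∫ p in cube 2, ‖F k p‖ = |1 / ν| ^ (k + 1) / ((k : ℝ) + 1) ^ 2 := by
    intro k
    have h : ∫ p in cube 2, ‖F k p‖ = ∫ p in cube 2, |1 / ν| ^ (k + 1) * (p 0 * p 1) ^ k := by
      refine setIntegral_congr_fun measurableSet_cube fun p hp => ?_
      simp only [hF]
      rw [Real.norm_eq_abs, abs_mul, abs_pow, abs_pow, abs_of_nonneg (hu p hp).1]
    rw [h, integral_const_mul, integral_cube_two_mul_pow, mul_one_div]
  -- summability of the norms: dominated by the geometric series `∑ |1/ν|^(k+1)`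
  have hsum : Summable fun k => ∫ p in cube 2, ‖F k p‖ := by
    simp_rw [hnorm]
    have hρ0 : 0 ≤ |1 / ν| := abs_nonneg _
    have hg : Summable fun k : ℕ => |1 / ν| * |1 / ν| ^ k :=
      (summable_geometric_of_lt_one hρ0 hρ1).mul_left _
    refine Summable.of_nonneg_of_le (fun k => by positivity) (fun k => ?_) hg
    rw [← pow_succ', div_le_iff₀ (by positivity)]
    have hk : (1 : ℝ) ≤ ((k : ℝ) + 1) ^ 2 := by
      nlinarith [(k.cast_nonneg : (0 : ℝ) ≤ k)]
    nlinarith [pow_nonneg hρ0 (k + 1)]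
  -- termwise integration
  rw [setIntegral_congr_fun measurableSet_cube hexp,
    ← integral_tsum_of_summable_integral_norm hint hsum]
  exact tsum_congr hval

/-! ## The negative integer level `ν = 1 − q`, `q ≥ 3` -/

/-- **J5, the value of the negative-level weight-two normal form of the Landen-join island**: for a
natural `q ≥ 3`, `∫_{[0,1]²} dx dy/((1 − q) − x y) = ∑_{k ≥ 0} (1/(1 − q))^{k+1}/(k+1)²
(= Li₂(1/(1 − q)))`, the real-level series `integral_cube_two_one_div_absLevel` at the level
`ν = 1 − q`, `|ν| = q − 1 ≥ 2 > 1`. [folklore] -/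
theorem stub_joinValueNegLevel : ∀ (q : ℕ), 3 ≤ q →
    ∫ p in cube 2, 1 / ((1 - (q : ℝ)) - p 0 * p 1) =
      ∑' k : ℕ, (1 / (1 - (q : ℝ))) ^ (k + 1) / ((k : ℝ) + 1) ^ 2 := by
  intro q hq
  have hq' : (3 : ℝ) ≤ (q : ℝ) := by exact_mod_cast hq
  refine integral_cube_two_one_div_absLevel _ ?_
  rw [abs_of_neg (by linarith)]
  linarith

end Summit.KontsevichZagierPeriods.HermiteRigidity.ReductionRigidity
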